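import Summits.Ventures.PercRepro.C026PFunLeaf
import Summits.Ventures.PercRepro.C026PFunSlack
import Summits.Ventures.PercRepro.C026PFunStarPos

/-!
# The pendant-probe recursion, its positivity, and THEOREM T for one-ended paths (p6, gen 16)

`IsLeafAt.pFun_eq`: `(2 − x_c)·(P_F) = (3 − 4x_c)m̂ − ẑ + K_c(x_c m̂ + (4 − 3x_c)ẑ) + (2 − x_c)K_c·P_u`
for a leaf probe `c` attached to `u` (mine-3 §28 (i) with one child: the bracket
`(3 − ξ) − 4x_c + 2K_c(π̃ + 2ξ) − K_c x_c(π̃ + 3ξ − 1)` at the virtual component `ξ = ẑ/m̂`,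
`π̃ = P_u/m̂`).  `IsLeafAt.pFun_nonneg`: `(P_u) ≥ 0` ⟹ `(P_F) ≥ 0` at band states — the bracket is
nondecreasing in `π̃` and at `π̃ = max 0 (1 − 2ξ)` it is the one-pendant star closed form at the corner
`(ξ, K_min ξ)`, `≥ 0` by THEOREM S.  Hence **THEOREM T for one-ended paths** (`ProbePath.pFun_nonneg`):
CONJECTURE (P) on every path skeleton with the probe at an end, every band state.
-/

namespace PercRepro

namespace MultiGraph

open Finset

variable {V E : Type*} [Fintype V] [DecidableEq V] [Fintype E] [DecidableEq E] {G : MultiGraph V E}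

section Leaf

variable {F : Finset E} {e : E} {c u : V} (h : IsLeafAt G F e c u)
include h

variable (x K : V → ℝ)

/-- **The pendant-probe recursion (mine-3 §28 (i), one child)**:
`(2 − x_c)·(P_F) = (3 − 4x_c)m̂ − ẑ + K_c(x_c m̂ + (4 − 3x_c)ẑ) + (2 − x_c)K_c·(P_{F−e})_u`. -/
theorem IsLeafAt.pFun_eq :
    (2 - x c) * G.pFun c x K F =
      (3 - 4 * x c) * G.mSum x u (F.erase e) - G.zSum x u (F.erase e) +
        K c * (x c * G.mSum x u (F.erase e) + (4 - 3 * x c) * G.zSum x u (F.erase e)) +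
        (2 - x c) * K c * G.pFun u x K (F.erase e) := by
  unfold pFun
  rw [sum_configsIn_split h.mem, mul_add, Finset.mul_sum, Finset.mul_sum,
    Finset.sum_congr rfl fun ω hω => h.closed_term x K hω,
    Finset.sum_congr rfl fun ω hω => h.open_term x K hω, Finset.sum_add_distrib,
    Finset.sum_add_distrib, ← Finset.mul_sum,
    sum_complIn_eq (F.erase e) fun ω => (2 - x c * G.xCluster x u ω) * G.nbarOff x u ω]
  unfold mSum zSum
  have e1 : ∑ ω ∈ configsIn (F.erase e), (2 - G.xCluster x u ω) * G.nbarOff x u ω * (1 - 2 * x c) =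
      (2 * ∑ ω ∈ configsIn (F.erase e), G.nbarOff x u ω -
        ∑ ω ∈ configsIn (F.erase e), G.xCluster x u ω * G.nbarOff x u ω) * (1 - 2 * x c) := by
    rw [Finset.mul_sum, ← Finset.sum_sub_distrib, Finset.sum_mul]
    exact Finset.sum_congr rfl fun ω _ => by ring
  have e2 : ∑ ω ∈ configsIn (F.erase e), (2 - x c * G.xCluster x u ω) * G.nbarOff x u ω =
      2 * ∑ ω ∈ configsIn (F.erase e), G.nbarOff x u ω -
        x c * ∑ ω ∈ configsIn (F.erase e), G.xCluster x u ω * G.nbarOff x u ω := by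
    rw [Finset.mul_sum, Finset.mul_sum, ← Finset.sum_sub_distrib]
    exact Finset.sum_congr rfl fun ω _ => by ring
  have e3 : ∑ ω ∈ configsIn (F.erase e), G.nbarOff x u ω * (1 - 2 * (x c * G.xCluster x u ω)) =
      ∑ ω ∈ configsIn (F.erase e), G.nbarOff x u ω -
        2 * x c * ∑ ω ∈ configsIn (F.erase e), G.xCluster x u ω * G.nbarOff x u ω := by
    rw [Finset.mul_sum, ← Finset.sum_sub_distrib]
    exact Finset.sum_congr rfl fun ω _ => by ring
  have e4 : ∑ ω ∈ configsIn (F.erase e),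
      (2 - x c) * (K c * G.kCluster K u ω) * G.nbar x (complIn (F.erase e) ω) =
      (2 - x c) * K c * ∑ ω ∈ configsIn (F.erase e),
        G.kCluster K u ω * G.nbar x (complIn (F.erase e) ω) := by
    rw [Finset.mul_sum]
    exact Finset.sum_congr rfl fun ω _ => by ring
  have e5 : ∑ ω ∈ configsIn (F.erase e),
      (G.nbarOff x u ω * (1 - 2 * G.xCluster x u ω) +
        G.kCluster K u ω * G.nbar x (complIn (F.erase e) ω)) =
      (∑ ω ∈ configsIn (F.erase e), G.nbarOff x u ω -
        2 * ∑ ω ∈ configsIn (F.erase e), G.xCluster x u ω * G.nbarOff x u ω) +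
        ∑ ω ∈ configsIn (F.erase e), G.kCluster K u ω * G.nbar x (complIn (F.erase e) ω) := by
    rw [Finset.sum_add_distrib, Finset.mul_sum, ← Finset.sum_sub_distrib]
    congr 1
    exact Finset.sum_congr rfl fun ω _ => by ring
  rw [e1, e2, e3, e4, e5]
  ring

/-- **Positivity through a pendant probe**: if `(P) ≥ 0` for the sub-skeleton with probe `u`, then
`(P) ≥ 0` for the skeleton with the leaf probe `c` (band states). -/
theorem IsLeafAt.pFun_nonneg (hx : ∀ v, 0 ≤ x v ∧ x v ≤ 1) (hK : ∀ v, kMin (x v) ≤ K v)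
    (hu : 0 ≤ G.pFun u x K (F.erase e)) : 0 ≤ G.pFun c x K F := by
  have hrec := h.pFun_eq x K
  have hm := one_le_mSum (G := G) hx u (F.erase e)
  have hz := zSum_le_mSum (G := G) hx u (F.erase e)
  have hK0 : ∀ v, 0 ≤ K v := fun v => (kMin_nonneg _).trans (hK v)
  have hlow := mSum_sub_two_zSum_le_pFun (G := G) hx hK0 u (F.erase e)
  have hc2 : 0 < 2 - x c := by linarith [(hx c).2]
  -- the bracket at the virtual component `(ξ, π̃)`, `ξ = ẑ/m̂`, `π̃ = P_u/m̂`
  set m := G.mSum x u (F.erase e) with hm_def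
  set z := G.zSum x u (F.erase e) with hz_def
  set P := G.pFun u x K (F.erase e) with hP_def
  have hmpos : 0 < m := by linarith
  -- reduce to `π̃ = max 0 (1 − 2ξ)`, i.e. `P₀ = max 0 (m − 2z)`, by monotonicity in `P`
  have hmono : 0 ≤ (2 - x c) * K c * (P - max 0 (m - 2 * z)) :=
    mul_nonneg (mul_nonneg hc2.le (hK0 c)) (sub_nonneg.2 (max_le hu hlow))
  -- the reduced bracket is the one-pendant star closed form at the corner `(ξ, K_min ξ)`
  set ξ := z / m with hξ_def
  have hξ : 0 ≤ ξ ∧ ξ ≤ 1 := ⟨div_nonneg hz.1 hmpos.le, (div_le_one hmpos).2 hz.2⟩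
  have hzξ : z = ξ * m := by rw [hξ_def, div_mul_cancel₀ _ hmpos.ne']
  have hcorner : max 0 (m - 2 * z) = m * max 0 (1 - 2 * ξ) := by
    rw [hzξ, show m - 2 * (ξ * m) = m * (1 - 2 * ξ) by ring]
    rcases le_or_gt (1 - 2 * ξ) 0 with h1 | h1
    · rw [max_eq_left (mul_nonpos_of_nonneg_of_nonpos hmpos.le h1), max_eq_left h1, mul_zero]
    · rw [max_eq_right (mul_nonneg hmpos.le h1.le), max_eq_right h1.le]
  have hkey : (2 - ξ) * kMin ξ = max 0 (1 - 2 * ξ) + 2 * ξ - 1 := by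
    rcases le_or_gt ξ (1 / 2) with h1 | h1
    · rw [kMin_eq_zero_of_le h1, max_eq_right (by linarith)]
      ring
    · rw [kMin_eq_of_half_le h1.le hξ.2, max_eq_left (by linarith),
        mul_div_cancel₀ _ (by linarith : (2 : ℝ) - ξ ≠ 0)]
      ring
  -- the star with one pendant vertex `(ξ, K_min ξ)` and probe `(x c, K c)`
  have hstar : 0 ≤ (star Unit).pFun none (fun v => Option.elim v (x c) fun _ => ξ)
      (fun v => Option.elim v (K c) fun _ => kMin ξ) univ := by
    refine pFun_star_nonneg (fun v => ?_) (fun v => ?_)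
    · cases v
      · exact hx c
      · exact hξ
    · cases v
      · exact hK c
      · exact le_rfl
  rw [pFun_star_eq] at hstar
  simp only [Fintype.prod_unique, Option.elim, Fintype.card_unique] at hstar
  rw [hkey] at hstar
  -- assemble: `(2 − x_c)(P_c) = m·bracket(π̃) ≥ m·bracket(π̃₀) ≥ 0`
  have hfinal : 0 ≤ (2 - x c) * G.pFun c x K F := by
    rw [hrec]
    have : (3 - 4 * x c) * m - z + K c * (x c * m + (4 - 3 * x c) * z) + (2 - x c) * K c * P =
        m * ((3 - ξ) - 2 ^ 2 * x c + 2 * K c * (1 + (max 0 (1 - 2 * ξ) + 2 * ξ - 1)) -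
          K c * x c * ((max 0 (1 - 2 * ξ) + 2 * ξ - 1) + ξ)) +
          (2 - x c) * K c * (P - max 0 (m - 2 * z)) := by
      rw [hcorner, hzξ]
      ring
    rw [this]
    exact add_nonneg (mul_nonneg hmpos.le hstar) hmono
  exact nonneg_of_mul_nonneg_right hfinal hc2

end Leaf

/-! ### THEOREM T for one-ended paths -/

/-- `ProbePath G c F`: the edge set `F` is a simple path starting at the probe `c` (every vertex,
once passed, is touched by no later edge); `F = ∅` allowed. -/
inductive ProbePath (G : MultiGraph V E) : V → Finset E → Prop
  | nil (c : V) : ProbePath G c ∅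
  | cons {c u : V} {e : E} {F : Finset E} (he : e ∉ F) (hfst : G.fst e = c) (hsnd : G.snd e = u)
      (hne : u ≠ c) (havoid : ∀ f ∈ F, G.fst f ≠ c ∧ G.snd f ≠ c) (h : ProbePath G u F) :
      ProbePath G c (insert e F)

/-- **THEOREM T for one-ended paths (mine-3 §28)**: CONJECTURE (P) holds on every path skeleton
with the probe at an end (plus isolated vertices), at every band state — by the pendant-probe
recursion along the path. -/
theorem ProbePath.pFun_nonneg {c : V} {F : Finset E} (hp : ProbePath G c F) (x K : V → ℝ)
    (hx : ∀ v, 0 ≤ x v ∧ x v ≤ 1) (hK : ∀ v, kMin (x v) ≤ K v) : 0 ≤ G.pFun c x K F := by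
  induction hp with
  | nil c =>
    rw [pFun_empty]
    exact mul_nonneg (nbarOff_nonneg hx c _) (slackOne_nonneg_of_kMin_le (hx c).2 (hK c))
  | @cons c u e F he hfst hsnd hne havoid _ ih =>
    have hleaf : IsLeafAt G (insert e F) e c u :=
      ⟨Finset.mem_insert_self e F, hfst, hsnd, hne,
        fun f hf hfe => havoid f (Finset.mem_of_mem_insert_of_ne hf hfe)⟩
    refine hleaf.pFun_nonneg x K hx hK ?_
    rw [Finset.erase_insert he]
    exact ih

end MultiGraph

end PercRepro
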